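import Summits.BirchSwinnertonDyer.Rank1Residual.Additive.X4SharpThreeKimShape
import Literature.NumberTheory.EllipticCurves.Kim2025.LargeImageStructureOPEN
import HarnessLib

/-!
# N11 — RA3(iii) BRIDGE: the typed OPEN Kim–Pollack 2025 facts (T-a4, `Literature/…/Kim2025/`)
# IMPLY the T-a2 conjectures `KimThree`, `KimThreeUnit`, `X4SharpThreeKim`, `X4SharpThreeKimUnit`
# (cell `b2b-bsdres`, team n1011, seat p03, OWNERS row T-a2; THEOREMS ONLY; referee-1 ruling RA3 (iii))

HONEST FRAMING (cell `b2b-bsdres`, run/shared/lean/b2b/bsd-rank1-residual/, verbatim in every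
file): the goal of the cell is to DELETE the COMBINATION-SHAPED residual classes of the
Birch–Swinnerton-Dyer formula for ALL analytic-rank `≤ 1` elliptic curves over `ℚ` — "full BSD
formula for every rank `≤ 1` curve in class `C`" assembled STRICTLY from published theorems — so
that the rank-`≤ 1` remainder becomes exactly the CONSTRUCTION-SHAPED classes, which are TYPED
(missing-input `Prop`s), NOT attempted. This is not "finishing BSD". Team n1011 (N10 / N11): prove
what is provable now; shrink each hard class to its core with data; no claim beyond stated classes.
Research routes; census output = EVIDENCE / conjecture items, never a Literature fact. The label X4
is UNCHANGED by this file; nothing is booked. ANNOUNCED ≠ PROVED: the hypotheses `hK25…` below are the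
typed OPEN `Prop`s of the UNREFEREED preprint Kim–Pollack arXiv:2505.09121v1 (seat p09, OWNERS row
T-a4; flags `Kim2025-preprint`, `Kim2025-OmegaE-integrality`); every theorem here is CONDITIONAL on
them and credits nothing.

## What this file proves (referee-1 RA3 (iii): "once T-a4 lands, T-a2 APPENDS a kernel lemma
`kimThree_of_kim2025_OPEN : <Kim2025 fact> → KimThree` so the two channels cannot drift")

The two channels carry the SAME statement: T-a2's `@[conjecture]` per-pair predicates
`KimRankZeroBoundAt W p` / `KimRankZeroUnitBoundAt W p` (Kim-2026 binder shape: `Surj W p`, tower,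
`L(E,1) ≠ 0`, `Ш` finite, datum `D` with `p ∤ c_D` [, period transfer, cyclic level, unit Kurihara
number]) and T-a4's `Kim2025.rankZero_padicValNat_sha_le_of_towerSurj_OPEN` /
`Kim2025.rankZero_padicValRat_sha_of_kuriharaNumber_ne_zero_of_towerSurj_OPEN` (`3 ≤ p`, tower, same
remaining binders; the `Ω(W)`/Manin-datum currency, flagged `Kim2025-OmegaE-integrality` by T-a4 as
weaker-than-print modulo the `Ω_E`-integrality of the modular symbols). Hence, one line each:
`kimRankZeroBoundAt_of_kim2025_OPEN` / `kimRankZeroUnitBoundAt_of_kim2025_OPEN` (every `p ≥ 3`),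
`kimThree_of_kim2025_OPEN`, `kimThreeUnit_of_kim2025_OPEN`, `x4SharpThreeKim_of_kim2025_OPEN`,
`x4SharpThreeKimUnit_of_kim2025_OPEN`. The own-currency `Prop`s (`cor17_…_integralPeriod_OPEN`,
`thm11_kimShaLength_of_integralPeriod_OPEN`: integral periods of the plus symbols, no Manin binder)
reach these shapes through T-a4's period bridge (`Additive/X4KimLargeImageIntegralPeriod.lean`, p09)
and cc-typer-1's `X4.kimShaLengthRankZeroAt_of_kimShaLengthAt` composed with this seat's
`kimRankZero{Lower,UpperDiv}BoundAt_of_kimShaLengthRankZeroAt` (`X4SharpThreeKimPartialBridge.lean`);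
not repeated here.

References: C.-H. Kim (app. R. Pollack), arXiv:2505.09121v1 (2025) Thm. 1.1, Thm. 1.2, Cor. 1.7 (PRE)
[Kim2025RefinedTNC]; R. Sakamoto, JTNB 36 (2024) 919–946 [Sakamoto2024KolyvaginThree]; C.-H. Kim,
AJM 148 (2026) Thm. 1.8 [Kim2022StructureSelmer].
-/

noncomputable section

open scoped Classical MatrixGroups ModularForm

open CongruenceSubgroup WeierstrassCurve Literature.NumberTheory.EllipticCurves
  Literature.NumberTheory.EllipticCurves.ModularForms
  Literature.NumberTheory.EllipticCurves.Rank1Residual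
  Literature.NumberTheory.EllipticCurves.Rank1Residual.Typed

namespace Summit.BirchSwinnertonDyer.Rank1Residual.Additive

variable (W : WeierstrassCurve ℚ) [W.IsElliptic] [W.IsGloballyMinimal] (p : ℕ) [Fact p.Prime]

/-- **T-a4's OPEN inequality fact ⟹ `KimRankZeroBoundAt W p` at every `p ≥ 3`** (the `Surj W p`
binder of the T-a2 shape is simply not needed). CONDITIONAL on the unrefereed announcement (flag
`Kim2025-preprint`). [cite: Kim2025RefinedTNC, Thm. 1.1, Thm. 1.2 (rk0), Cor. 1.7 (ANNOUNCED, OPEN hypothesis)] -/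
theorem kimRankZeroBoundAt_of_kim2025_OPEN
    (hK25 : Kim2025.rankZero_padicValNat_sha_le_of_towerSurj_OPEN) (hp : 3 ≤ p) :
    KimRankZeroBoundAt W p :=
  fun _ htower hL hfin _ _ D hc => hK25 W p hp htower hL hfin D hc

/-- **T-a4's OPEN unit-Kurihara fact ⟹ `KimRankZeroUnitBoundAt W p` at every `p ≥ 3`.**
CONDITIONAL on the unrefereed announcement (flag `Kim2025-preprint`).
[cite: Kim2025RefinedTNC, Thm. 1.1, Thm. 1.2 (rk0), Cor. 1.7 (ANNOUNCED, OPEN hypothesis)] -/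
theorem kimRankZeroUnitBoundAt_of_kim2025_OPEN
    (hK25 : Kim2025.rankZero_padicValRat_sha_of_kuriharaNumber_ne_zero_of_towerSurj_OPEN)
    (hp : 3 ≤ p) : KimRankZeroUnitBoundAt W p :=
  fun _ htower hL hfin _ _ D hc hper n _ hn hcyc ψ hψ hδ =>
    hK25 W p hp htower hL hfin D hc hper n hn hcyc ψ hψ hδ

/-- **RA3 (iii): `kimThree_of_kim2025_OPEN`** — the announced Kim–Pollack statement (T-a4's typed
OPEN `Prop`, `Ω(W)` currency) implies T-a2's conjecture `KimThree`. CONDITIONAL (PRE).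
[cite: Kim2025RefinedTNC, Cor. 1.7 (ANNOUNCED, OPEN hypothesis)] -/
theorem kimThree_of_kim2025_OPEN (hK25 : Kim2025.rankZero_padicValNat_sha_le_of_towerSurj_OPEN) :
    KimThree :=
  fun W _ _ => kimRankZeroBoundAt_of_kim2025_OPEN W 3 hK25 le_rfl

/-- **RA3 (iii), unit shape: `kimThreeUnit_of_kim2025_OPEN`.** CONDITIONAL (PRE).
[cite: Kim2025RefinedTNC, Cor. 1.7 (ANNOUNCED, OPEN hypothesis)] -/
theorem kimThreeUnit_of_kim2025_OPEN
    (hK25 : Kim2025.rankZero_padicValRat_sha_of_kuriharaNumber_ne_zero_of_towerSurj_OPEN) :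
    KimThreeUnit :=
  fun W _ _ => kimRankZeroUnitBoundAt_of_kim2025_OPEN W 3 hK25 le_rfl

/-- **The N11 hypothesis from the announcement: `x4SharpThreeKim_of_kim2025_OPEN`.** CONDITIONAL (PRE).
[cite: Kim2025RefinedTNC, Cor. 1.7 (ANNOUNCED, OPEN hypothesis)] -/
theorem x4SharpThreeKim_of_kim2025_OPEN (hK25 : Kim2025.rankZero_padicValNat_sha_le_of_towerSurj_OPEN) :
    X4SharpThreeKim :=
  x4SharpThreeKim_of_kimThree (kimThree_of_kim2025_OPEN hK25)

/-- **The N11 unit/EQUALITY hypothesis from the announcement: `x4SharpThreeKimUnit_of_kim2025_OPEN`**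
— so the LOWER lever of `X4SharpThreeKimUnitLever` (`X4RankZero.bsdp_three_of_kimUnitShape_of_cert_of_kuriharaUnitAt`)
runs on T-a4's typed OPEN fact + ONE unit Kurihara number per row. CONDITIONAL (PRE).
[cite: Kim2025RefinedTNC, Cor. 1.7, §8.1.1 (ANNOUNCED, OPEN hypothesis)] -/
theorem x4SharpThreeKimUnit_of_kim2025_OPEN
    (hK25 : Kim2025.rankZero_padicValRat_sha_of_kuriharaNumber_ne_zero_of_towerSurj_OPEN) :
    X4SharpThreeKimUnit :=
  x4SharpThreeKimUnit_of_kimThreeUnit (kimThreeUnit_of_kim2025_OPEN hK25)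

end Summit.BirchSwinnertonDyer.Rank1Residual.Additive

end
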